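import Summits.ValiantsHypothesis.ValiantsHypothesis.Theorems.LacunarySymmetroidMatrixDescartesCensusV19GCheck
import Summits.ValiantsHypothesis.ValiantsHypothesis.Theorems.LacunarySymmetroidMatrixDescartesCensusV19SModel

/-!
# `MatrixDescartes` census — semantics of the `V19G` checker (general window rows; definitions)

HONEST FRAMING.  Object-search cell `pub-symmetroid`; door-A item `DoorA26 = PosRootLawAt 2 6 19` (stmt-ValiantsHypothesis-19979; OPEN, typed,
never asserted) and its sharper support rows `PosRootLawOn 2 6 18 d`.  DEFINITIONS ONLY: the real-valued semantics of `…CensusV19GCheck` on top of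
door-p4 g5's `V19S.Model` (imported UNCHANGED): the real sign `twistSgnR` of a twisted window term (`−1` if `V19G.twistNeg`, else `1`), the general
window term `gterm c x Ws t y = x_t · P_t · y^{E_t}` with the REDUCED weight `P_t = fval (V19S.redW E Ws E_t 1)` of an arbitrary window with sums
`Ws`, and the `V19G.Model` of a cell = a `V19S.Model` PLUS the GENERAL WINDOW BALANCES of mode `A`: for every four positions `a < b < e < f < 21`
there is `y > 0` with `Σ_{t ∈ {a,b,e,f}} twistSgnR_t · gterm_t(y) = 0` — what `Census.window4_balance_support` (…CensusGeneralWindow, val-sym-door-p5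
g5) supplies for a hypothetical nineteen with all `21` coefficients non-zero (the twisted coefficient `c_t · ∏_{u ∉ W}(E_t − E_u)` has sign
`sign(c_t) · (−1)^{#{u ∉ W : E_u > E_t}}` and modulus `x_t · P_t`).  The proofs (`…CensusV19GSound*`) show that a model refutes every accepted
`V19G` certificate and that a nineteen (given the `V = 20` row of its support) yields a model.  Nothing here bears on the one-collision supports,
on `ζ_sym(2,6)` over all supports, on `MatrixDescartes` (stmt-ValiantsHypothesis-18050) or on `VP ≠ VNP`.

[folklore] Bookkeeping; elementary.
-/

-- the D-0017 layout repeats a namespace component (single-conjunct summit); the `dupNamespace` linter flags it; name mandated.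
set_option linter.dupNamespace false

namespace Summit.ValiantsHypothesis.ValiantsHypothesis.Theorems.LacunarySymmetroidMatrixDescartes.Census.V19G

open V20 (Atom fval)
open V19S (Ctx Mode redW)

/-! ## Twisted signs and general window terms -/

/-- Real sign of the twisted term of position `t` for the window with sums `Ws`: `−1` if `twistNeg`, else `1`. [folklore] -/
noncomputable def twistSgnR (c : Ctx) (Ws : List ℕ) (t : ℕ) : ℝ := if twistNeg c Ws t then -1 else 1

/-- The REDUCED weight `P_t = ∏_{u ∈ E, u ∉ Ws} |E_t − u|` of position `t` for the window sums `Ws`, as a real (the value of the checker's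
factored natural `V19S.redW … 1`). [folklore] -/
noncomputable def gredWR (c : Ctx) (Ws : List ℕ) (t : ℕ) : ℝ := (fval (redW c.E Ws (c.E.getD t 0) 1) : ℝ)

/-- The general window term of position `t` at the point `y`: `x_t · P_t · y^{E_t}`. [folklore] -/
noncomputable def gterm (c : Ctx) (x : ℕ → ℝ) (Ws : List ℕ) (t : ℕ) (y : ℝ) : ℝ := x t * gredWR c Ws t * y ^ (c.E.getD t 0)

/-! ## The model of a cell -/

/-- What a hypothetical pencil with `19` distinct positive det-roots on a 2-Sidon support supplies in the cell it realises: everything of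
`V19S.Model` (door-p4 g5), and — in mode `A` (all coefficients non-zero) — for every window of four positions `a < b < e < f` a positive point
where the four TWISTED window terms balance (`Census.window4_balance_support`). [folklore] -/
structure Model (c : Ctx) (x : ℕ → ℝ) (v : Atom → ℝ) : Prop where
  /-- the `V19S` model of the cell -/
  base : V19S.Model c x v
  /-- mode A: the general four-term window balance at some positive point -/
  gbal : ∀ k a b e f, c.mode = .A k → a < b → b < e → e < f → f < 21 → ∃ y : ℝ, 0 < y ∧
    twistSgnR c (wsums c.E [a, b, e, f]) a * gterm c x (wsums c.E [a, b, e, f]) a y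
      + twistSgnR c (wsums c.E [a, b, e, f]) b * gterm c x (wsums c.E [a, b, e, f]) b y
      + twistSgnR c (wsums c.E [a, b, e, f]) e * gterm c x (wsums c.E [a, b, e, f]) e y
      + twistSgnR c (wsums c.E [a, b, e, f]) f * gterm c x (wsums c.E [a, b, e, f]) f y = 0

end Summit.ValiantsHypothesis.ValiantsHypothesis.Theorems.LacunarySymmetroidMatrixDescartes.Census.V19G
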